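import Summits.BirchSwinnertonDyer.BirchSwinnertonDyer.Theorems.CyclotomicUntwistPSLocalThreeStableLineIIstar
import HarnessLib

/-!
# Valued-field algebra for the DICYCLIC wild rows at `3`, part 2: Tate's `IV` shape with `w Δ = e⁻⁵`
# (every root of `Ψ₃` is a unit; at most one root)

Cell `pub/bsd-wall` (D-0145 line `route-BirchSwinnertonDyer-CyclotomicUntwist`), seat `bsd-line-cycu-p2`
(prover seat 2/3, gen 3); helper toward K1/K2 (stmt-BirchSwinnertonDyer-21580 / 21581) and the O6 lane
(`WildThreeTameTorsionCellLaw`, conjecture-tagged): the valued-field core of "at most one `ℚ₃`-root of `Ψ₃`"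
on the dicyclic cells `(3, IV)` (row `(2,3,5)`) and, rescaled, `(3, II*)` (row `(4,6,11)`). THEOREMS ONLY over
an abstract valued field `(F, w)` with `w 3 = e⁻¹` (no definition, no named fact, no `sorry`); BSD is not proved
by this file and no crux is.

* `shapeIV_five_bounds`: `b₂ ∈ 3𝒪`, `b₄ ∈ 9𝒪`, `w b₆ = e⁻²`, `w Δ = e⁻⁵` ⟹ `w b₂ = e⁻¹` and `w b₈ = e⁻³`
  (`w b₂ ≤ e⁻²` would put every term of `Δ` at most `e⁻⁶`; then `b₂b₆` dominates `4b₈ = b₂b₆ − b₄²`);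
* `map_root_eq_one_of_shapeIV_five`: every root of `Ψ₃` is a UNIT (`b₈` dominates on `3𝒪`, `3r⁴` outside `𝒪`);
* `root_unique_of_shapeIV_five`: two roots `r, s` both satisfy `w(3r + b₂) ≤ e⁻³`, so `w(r − s) ≤ e⁻²`, and then
  `12r³` dominates the difference quotient strictly — at most one root.
References: J. H. Silverman, *Advanced Topics* (1994), IV.9.4 Step 5 [SilvermanATAEC1994]; I. Papadopoulos,
J. Number Theory 44 (1993), Table (p = 3) [Papadopoulos1993].
-/

set_option autoImplicit false
-- single-conjunct summit: `Summit.BirchSwinnertonDyer.BirchSwinnertonDyer.…` repeats the name by design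
set_option linter.dupNamespace false

noncomputable section

open scoped Classical

open WeierstrassCurve WithZero Summit.BirchSwinnertonDyer.Rank1Residual.O5.NonSplitAtThree

open Summit.BirchSwinnertonDyer.Rank1Residual.Additive.ThreeAdicLift (le_exp_sub_one_of_lt_exp)

namespace Summit.BirchSwinnertonDyer.BirchSwinnertonDyer.Theorems.PSLocalThreeTorsion

section Valued

variable {F : Type*} [Field F] (w : Valuation F ℤᵐ⁰) {ϖ : F}

/-- **Type-`IV` shape with `w Δ = exp (−5)`: `w b₂ = e⁻¹` and `w b₈ = e⁻³`** (`w b₂ ≤ e⁻²` would put every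
term of `Δ` at most `e⁻⁶`; then `b₂b₆` dominates `4b₈ = b₂b₆ − b₄²`). [cite: SilvermanATAEC1994, IV.9.4 Step 5] -/
theorem shapeIV_five_bounds (h3 : (3 : F) = ϖ) (hϖ : w ϖ = exp (-1 : ℤ)) {b₂ b₄ b₆ b₈ : F}
    (hb₂ : w b₂ ≤ exp (-1 : ℤ)) (hb₄ : w b₄ ≤ exp (-2 : ℤ)) (hb₆ : w b₆ = exp (-2 : ℤ))
    (hrel : 4 * b₈ = b₂ * b₆ - b₄ ^ 2)
    (hΔ : w (-b₂ ^ 2 * b₈ - 8 * b₄ ^ 3 - 27 * b₆ ^ 2 + 9 * b₂ * b₄ * b₆) = exp (-5 : ℤ)) :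
    w b₂ = exp (-1 : ℤ) ∧ w b₈ = exp (-3 : ℤ) := by
  obtain ⟨w4, w8, -, w27, w9⟩ := map_consts w h3 hϖ
  have hT3 : w (27 * b₆ ^ 2) ≤ exp (-7 : ℤ) := by
    rw [map_mul, map_pow, hb₆]
    calc w 27 * exp (-2 : ℤ) ^ 2 ≤ exp (-3 : ℤ) * exp (-2 : ℤ) ^ 2 := mul_le_mul' w27 le_rfl
      _ = exp (-7 : ℤ) := by rw [← exp_nsmul, ← exp_add]; norm_num
  have hT2 : w (8 * b₄ ^ 3) ≤ exp (-6 : ℤ) := by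
    rw [map_mul, map_pow, w8, one_mul]
    calc w b₄ ^ 3 ≤ exp (-2 : ℤ) ^ 3 := pow_le_pow_left' hb₄ 3
      _ = exp (-6 : ℤ) := by rw [← exp_nsmul]; norm_num
  have hb₂eq : w b₂ = exp (-1 : ℤ) := by
    rcases hb₂.eq_or_lt with h2eq | h2lt
    · exact h2eq
    · exfalso
      have hb₂' : w b₂ ≤ exp (-2 : ℤ) := by
        have := le_exp_sub_one_of_lt_exp h2lt
        rwa [show (-1 : ℤ) - 1 = -2 by norm_num] at this
      have hb₈le : w b₈ ≤ exp (-4 : ℤ) := by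
        have h : w (4 * b₈) ≤ exp (-4 : ℤ) := by
          rw [hrel]
          refine Valuation.map_sub_le w ?_ ?_
          · calc w (b₂ * b₆) ≤ exp (-2 + -2 : ℤ) := map_mul_le_exp_add w hb₂' hb₆.le
              _ = exp (-4 : ℤ) := by norm_num
          · rw [map_pow]
            calc w b₄ ^ 2 ≤ exp (-2 : ℤ) ^ 2 := pow_le_pow_left' hb₄ 2
              _ = exp (-4 : ℤ) := by rw [← exp_nsmul]; norm_num
        rwa [map_mul, w4, one_mul] at h
      have hT1 : w (-b₂ ^ 2 * b₈) ≤ exp (-8 : ℤ) := by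
        rw [Valuation.map_mul, Valuation.map_neg, map_pow]
        calc w b₂ ^ 2 * w b₈ ≤ exp (-2 : ℤ) ^ 2 * exp (-4 : ℤ) :=
              mul_le_mul' (pow_le_pow_left' hb₂' 2) hb₈le
          _ = exp (-8 : ℤ) := by rw [← exp_nsmul, ← exp_add]; norm_num
      have hT4 : w (9 * b₂ * b₄ * b₆) ≤ exp (-8 : ℤ) := by
        rw [map_mul, map_mul, map_mul, hb₆]
        calc w 9 * w b₂ * w b₄ * exp (-2 : ℤ) ≤ exp (-2 : ℤ) * exp (-2 : ℤ) * exp (-2 : ℤ) * exp (-2 : ℤ) :=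
              mul_le_mul' (mul_le_mul' (mul_le_mul' w9 hb₂') hb₄) le_rfl
          _ = exp (-8 : ℤ) := by rw [← exp_add, ← exp_add, ← exp_add]; norm_num
      have hle : w (-b₂ ^ 2 * b₈ - 8 * b₄ ^ 3 - 27 * b₆ ^ 2 + 9 * b₂ * b₄ * b₆) ≤ exp (-6 : ℤ) :=
        Valuation.map_add_le w (Valuation.map_sub_le w (Valuation.map_sub_le w
          (hT1.trans (by rw [exp_le_exp]; norm_num)) hT2) (hT3.trans (by rw [exp_le_exp]; norm_num)))
          (hT4.trans (by rw [exp_le_exp]; norm_num))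
      rw [hΔ, exp_le_exp] at hle
      norm_num at hle
  refine ⟨hb₂eq, ?_⟩
  have hprod : w (b₂ * b₆) = exp (-3 : ℤ) := by
    rw [map_mul, hb₂eq, hb₆, ← exp_add]; norm_num
  have hsq : w (b₄ ^ 2) < w (b₂ * b₆) := by
    rw [hprod, map_pow]
    calc w b₄ ^ 2 ≤ exp (-2 : ℤ) ^ 2 := pow_le_pow_left' hb₄ 2
      _ < exp (-3 : ℤ) := by rw [← exp_nsmul, exp_lt_exp]; norm_num
  have h : w (4 * b₈) = exp (-3 : ℤ) := by
    rw [hrel, Valuation.map_sub_eq_of_lt_left w hsq, hprod]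
  rwa [map_mul, w4, one_mul] at h

/-- **Every root of `Ψ₃` is a UNIT on the type-`IV` shape with `w Δ = e⁻⁵`** (`w b₂ ≤ e⁻¹`, `w b₄, w b₆ ≤ e⁻²`,
`w b₈ = e⁻³`): for a root in `ϖ𝒪` the constant `b₈` dominates strictly; for a non-integral root `3r⁴` does
(read on `y = r⁻¹`). [folklore] -/
theorem map_root_eq_one_of_shapeIV_five (h3 : (3 : F) = ϖ) (hϖ : w ϖ = exp (-1 : ℤ)) {b₂ b₄ b₆ b₈ : F}
    (hb₂ : w b₂ ≤ exp (-1 : ℤ)) (hb₄ : w b₄ ≤ exp (-2 : ℤ)) (hb₆ : w b₆ ≤ exp (-2 : ℤ))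
    (hb₈ : w b₈ = exp (-3 : ℤ)) {r : F}
    (hr : 3 * r ^ 4 + b₂ * r ^ 3 + 3 * b₄ * r ^ 2 + 3 * b₆ * r + b₈ = 0) : w r = 1 := by
  have w3 := map_three w h3 hϖ
  have h3le : w 3 ≤ exp (-1 : ℤ) := w3.le
  rcases lt_trichotomy (w r) 1 with hlt | heq | hgt
  · exfalso
    have hr1 : w r ≤ exp (-1 : ℤ) := by
      have := le_exp_sub_one_of_lt_exp (n := 0) (by rwa [exp_zero])
      rwa [show (0 : ℤ) - 1 = -1 by norm_num] at this
    have hS : w (3 * r ^ 4 + b₂ * r ^ 3 + 3 * b₄ * r ^ 2 + 3 * b₆ * r) ≤ exp (-4 : ℤ) := by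
      refine Valuation.map_add_le w (Valuation.map_add_le w (Valuation.map_add_le w ?_ ?_) ?_) ?_
      · rw [map_mul, map_pow]
        calc w 3 * w r ^ 4 ≤ exp (-1 : ℤ) * exp (-1 : ℤ) ^ 4 := mul_le_mul' h3le (pow_le_pow_left' hr1 4)
          _ ≤ exp (-4 : ℤ) := by rw [← exp_nsmul, ← exp_add, exp_le_exp]; norm_num
      · rw [map_mul, map_pow]
        calc w b₂ * w r ^ 3 ≤ exp (-1 : ℤ) * exp (-1 : ℤ) ^ 3 := mul_le_mul' hb₂ (pow_le_pow_left' hr1 3)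
          _ ≤ exp (-4 : ℤ) := by rw [← exp_nsmul, ← exp_add, exp_le_exp]; norm_num
      · rw [map_mul, map_mul, map_pow]
        calc w 3 * w b₄ * w r ^ 2 ≤ exp (-1 : ℤ) * exp (-2 : ℤ) * exp (-1 : ℤ) ^ 2 :=
              mul_le_mul' (mul_le_mul' h3le hb₄) (pow_le_pow_left' hr1 2)
          _ ≤ exp (-4 : ℤ) := by rw [← exp_nsmul, ← exp_add, ← exp_add, exp_le_exp]; norm_num
      · rw [map_mul, map_mul]
        calc w 3 * w b₆ * w r ≤ exp (-1 : ℤ) * exp (-2 : ℤ) * exp (-1 : ℤ) :=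
              mul_le_mul' (mul_le_mul' h3le hb₆) hr1
          _ ≤ exp (-4 : ℤ) := by rw [← exp_add, ← exp_add, exp_le_exp]; norm_num
    have hlt' : w (3 * r ^ 4 + b₂ * r ^ 3 + 3 * b₄ * r ^ 2 + 3 * b₆ * r) < w b₈ := by
      rw [hb₈]; exact lt_of_le_of_lt hS (by rw [exp_lt_exp]; norm_num)
    have h := Valuation.map_add_eq_of_lt_right w hlt'
    rw [hr, map_zero, hb₈] at h
    exact exp_ne_zero h.symm
  · exact heq
  · exfalso
    have hr0 : r ≠ 0 := by
      rintro rfl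
      rw [map_zero] at hgt
      exact not_lt_of_ge zero_le hgt
    set y := r⁻¹ with hy
    have hry : r * y = 1 := mul_inv_cancel₀ hr0
    have hwy : w y < 1 := by
      refine lt_of_not_ge fun hle ↦ ?_
      have h1 : (1 : ℤᵐ⁰) < w r * w y := one_lt_mul_of_lt_of_le' hgt hle
      rw [← map_mul, hry, map_one] at h1
      exact lt_irrefl _ h1
    have hy1 : w y ≤ exp (-1 : ℤ) := by
      have := le_exp_sub_one_of_lt_exp (n := 0) (by rwa [exp_zero])
      rwa [show (0 : ℤ) - 1 = -1 by norm_num] at this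
    have hr' : 3 + (b₂ * y + 3 * b₄ * y ^ 2 + 3 * b₆ * y ^ 3 + b₈ * y ^ 4) = 0 := by
      linear_combination y ^ 4 * hr -
        (3 * (r ^ 3 * y ^ 3 + r ^ 2 * y ^ 2 + r * y + 1) + b₂ * y * (r ^ 2 * y ^ 2 + r * y + 1) +
          3 * b₄ * y ^ 2 * (r * y + 1) + 3 * b₆ * y ^ 3) * hry
    have hB : w (b₂ * y + 3 * b₄ * y ^ 2 + 3 * b₆ * y ^ 3 + b₈ * y ^ 4) ≤ exp (-2 : ℤ) := by
      refine Valuation.map_add_le w (Valuation.map_add_le w (Valuation.map_add_le w ?_ ?_) ?_) ?_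
      · calc w (b₂ * y) ≤ exp (-1 + -1 : ℤ) := map_mul_le_exp_add w hb₂ hy1
          _ = exp (-2 : ℤ) := by norm_num
      · rw [map_mul, map_mul, map_pow]
        calc w 3 * w b₄ * w y ^ 2 ≤ exp (-1 : ℤ) * exp (-2 : ℤ) * exp (-1 : ℤ) ^ 2 :=
              mul_le_mul' (mul_le_mul' h3le hb₄) (pow_le_pow_left' hy1 2)
          _ ≤ exp (-2 : ℤ) := by rw [← exp_nsmul, ← exp_add, ← exp_add, exp_le_exp]; norm_num
      · rw [map_mul, map_mul, map_pow]
        calc w 3 * w b₆ * w y ^ 3 ≤ exp (-1 : ℤ) * exp (-2 : ℤ) * exp (-1 : ℤ) ^ 3 :=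
              mul_le_mul' (mul_le_mul' h3le hb₆) (pow_le_pow_left' hy1 3)
          _ ≤ exp (-2 : ℤ) := by rw [← exp_nsmul, ← exp_add, ← exp_add, exp_le_exp]; norm_num
      · rw [map_mul, map_pow, hb₈]
        calc exp (-3 : ℤ) * w y ^ 4 ≤ exp (-3 : ℤ) * exp (-1 : ℤ) ^ 4 :=
              mul_le_mul' le_rfl (pow_le_pow_left' hy1 4)
          _ ≤ exp (-2 : ℤ) := by rw [← exp_nsmul, ← exp_add, exp_le_exp]; norm_num
    have hlt' : w (b₂ * y + 3 * b₄ * y ^ 2 + 3 * b₆ * y ^ 3 + b₈ * y ^ 4) < w 3 := by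
      rw [w3]; exact lt_of_le_of_lt hB (by rw [exp_lt_exp]; norm_num)
    have h := Valuation.map_add_eq_of_lt_left w hlt'
    rw [hr', map_zero, w3] at h
    exact exp_ne_zero h.symm

/-- **`Ψ₃` has at most ONE root on the type-`IV` shape with `w Δ = e⁻⁵`.** Two (unit) roots `r, s` both satisfy
`w(3r + b₂) ≤ e⁻³` (the other terms of `Ψ₃` are `≤ e⁻³`), so `w(r − s) ≤ e⁻²`; the difference quotient is
`12r³ + [3b₂r² + 3(s−r)(s²+2rs+3r²) + b₂(s−r)(s+2r) + 3b₄(r+s) + 3b₆]` with the bracket `≤ e⁻²` and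
`w(12r³) = e⁻¹` — it cannot vanish. [folklore] -/
theorem root_unique_of_shapeIV_five (h3 : (3 : F) = ϖ) (hϖ : w ϖ = exp (-1 : ℤ)) {b₂ b₄ b₆ b₈ : F}
    (hb₂ : w b₂ = exp (-1 : ℤ)) (hb₄ : w b₄ ≤ exp (-2 : ℤ)) (hb₆ : w b₆ = exp (-2 : ℤ))
    (hb₈ : w b₈ = exp (-3 : ℤ)) {r s : F}
    (hr : 3 * r ^ 4 + b₂ * r ^ 3 + 3 * b₄ * r ^ 2 + 3 * b₆ * r + b₈ = 0)
    (hs : 3 * s ^ 4 + b₂ * s ^ 3 + 3 * b₄ * s ^ 2 + 3 * b₆ * s + b₈ = 0) : r = s := by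
  have w3 := map_three w h3 hϖ
  obtain ⟨w4, -, -, -, -⟩ := map_consts w h3 hϖ
  have wr := map_root_eq_one_of_shapeIV_five w h3 hϖ hb₂.le hb₄ hb₆.le hb₈ hr
  have ws := map_root_eq_one_of_shapeIV_five w h3 hϖ hb₂.le hb₄ hb₆.le hb₈ hs
  by_contra hne
  have hrs : r - s ≠ 0 := sub_ne_zero.mpr hne
  -- (1) `w (3 t + b₂) ≤ e⁻³` at each unit root `t` (`t³ (3t + b₂) = −(3b₄t² + 3b₆t + b₈)`)
  have htail : ∀ t : F, w t = 1 → 3 * t ^ 4 + b₂ * t ^ 3 + 3 * b₄ * t ^ 2 + 3 * b₆ * t + b₈ = 0 →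
      w (3 * t + b₂) ≤ exp (-3 : ℤ) := by
    intro t ht hroot
    have ht0 : t ≠ 0 := by
      rintro rfl; rw [map_zero] at ht; exact zero_ne_one ht
    have ht3 : t ^ 3 ≠ 0 := pow_ne_zero 3 ht0
    have hid : 3 * t + b₂ = -(3 * b₄ * t ^ 2 + 3 * b₆ * t + b₈) * (t ^ 3)⁻¹ := by
      rw [eq_mul_inv_iff_mul_eq₀ ht3]
      linear_combination hroot
    rw [hid, map_mul, Valuation.map_neg, map_inv₀, map_pow, ht, one_pow, inv_one, mul_one]
    refine Valuation.map_add_le w (Valuation.map_add_le w ?_ ?_) hb₈.le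
    · rw [map_mul, map_mul, map_pow, ht, one_pow, mul_one, w3]
      calc exp (-1 : ℤ) * w b₄ ≤ exp (-1 : ℤ) * exp (-2 : ℤ) := mul_le_mul' le_rfl hb₄
        _ = exp (-3 : ℤ) := by rw [← exp_add]; norm_num
    · rw [map_mul, map_mul, ht, mul_one, w3, hb₆, ← exp_add, exp_le_exp]; norm_num
  -- (2) `w (r - s) ≤ e⁻²`
  have h30 : (3 : F) ≠ 0 := fun h ↦ by rw [h, map_zero] at w3; exact exp_ne_zero w3.symm
  have hd : w (r - s) ≤ exp (-2 : ℤ) := by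
    have h1 : w (3 * (r - s)) ≤ exp (-3 : ℤ) := by
      rw [show 3 * (r - s) = (3 * r + b₂) - (3 * s + b₂) by ring]
      exact Valuation.map_sub_le w (htail r wr hr) (htail s ws hs)
    have e : r - s = 3⁻¹ * (3 * (r - s)) := by field_simp
    rw [e, map_mul, map_inv₀, w3, ← exp_neg]
    calc exp (-(-1 : ℤ)) * w (3 * (r - s)) ≤ exp (-(-1 : ℤ)) * exp (-3 : ℤ) := mul_le_mul' le_rfl h1
      _ = exp (-2 : ℤ) := by rw [← exp_add]; norm_num
  -- (3) the difference quotient and its dominant term `12 r³`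
  have hq : 3 * (r ^ 3 + r ^ 2 * s + r * s ^ 2 + s ^ 3) + b₂ * (r ^ 2 + r * s + s ^ 2) + 3 * b₄ * (r + s) +
      3 * b₆ = 0 := by
    have h : (r - s) * (3 * (r ^ 3 + r ^ 2 * s + r * s ^ 2 + s ^ 3) + b₂ * (r ^ 2 + r * s + s ^ 2) +
        3 * b₄ * (r + s) + 3 * b₆) = (3 * r ^ 4 + b₂ * r ^ 3 + 3 * b₄ * r ^ 2 + 3 * b₆ * r + b₈) -
          (3 * s ^ 4 + b₂ * s ^ 3 + 3 * b₄ * s ^ 2 + 3 * b₆ * s + b₈) := by ring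
    rw [hr, hs, sub_zero, mul_eq_zero] at h
    exact h.resolve_left hrs
  have hsplit : 3 * (r ^ 3 + r ^ 2 * s + r * s ^ 2 + s ^ 3) + b₂ * (r ^ 2 + r * s + s ^ 2) + 3 * b₄ * (r + s) +
      3 * b₆ = 12 * r ^ 3 + (3 * b₂ * r ^ 2 + 3 * ((s - r) * (s ^ 2 + 2 * r * s + 3 * r ^ 2)) +
        b₂ * ((s - r) * (s + 2 * r)) + 3 * b₄ * (r + s) + 3 * b₆) := by ring
  have hsr : w (s - r) ≤ exp (-2 : ℤ) := by rw [← Valuation.map_neg, neg_sub]; exact hd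
  have hone : ∀ {x : F}, w x ≤ 1 → ∀ n : ℕ, w (x ^ n) ≤ 1 := fun hx n ↦ by
    rw [map_pow]; exact pow_le_one' hx n
  have hE : w (3 * b₂ * r ^ 2 + 3 * ((s - r) * (s ^ 2 + 2 * r * s + 3 * r ^ 2)) +
      b₂ * ((s - r) * (s + 2 * r)) + 3 * b₄ * (r + s) + 3 * b₆) ≤ exp (-2 : ℤ) := by
    have hw2 : w 2 ≤ 1 := (map_consts w h3 hϖ).2.2.1
    have hP : w (s ^ 2 + 2 * r * s + 3 * r ^ 2) ≤ 1 := by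
      refine Valuation.map_add_le w (Valuation.map_add_le w (hone ws.le 2) ?_) ?_
      · rw [map_mul, map_mul, wr, ws, mul_one, mul_one]; exact hw2
      · rw [map_mul, map_pow, wr, one_pow, mul_one]; exact w3.le.trans (by rw [← exp_zero, exp_le_exp]; norm_num)
    have hQ : w (s + 2 * r) ≤ 1 :=
      Valuation.map_add_le w ws.le (by rw [map_mul, wr, mul_one]; exact hw2)
    have hRS : w (r + s) ≤ 1 := Valuation.map_add_le w wr.le ws.le
    refine Valuation.map_add_le w (Valuation.map_add_le w (Valuation.map_add_le w
      (Valuation.map_add_le w ?_ ?_) ?_) ?_) ?_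
    · rw [map_mul, map_mul, map_pow, w3, hb₂, wr, one_pow, mul_one, ← exp_add, exp_le_exp]; norm_num
    · rw [map_mul, w3, map_mul]
      calc exp (-1 : ℤ) * (w (s - r) * w (s ^ 2 + 2 * r * s + 3 * r ^ 2)) ≤
          exp (-1 : ℤ) * (exp (-2 : ℤ) * 1) := mul_le_mul' le_rfl (mul_le_mul' hsr hP)
        _ ≤ exp (-2 : ℤ) := by rw [mul_one, ← exp_add, exp_le_exp]; norm_num
    · rw [map_mul, map_mul, hb₂]
      calc exp (-1 : ℤ) * (w (s - r) * w (s + 2 * r)) ≤ exp (-1 : ℤ) * (exp (-2 : ℤ) * 1) :=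
          mul_le_mul' le_rfl (mul_le_mul' hsr hQ)
        _ ≤ exp (-2 : ℤ) := by rw [mul_one, ← exp_add, exp_le_exp]; norm_num
    · rw [map_mul, map_mul, w3]
      calc exp (-1 : ℤ) * w b₄ * w (r + s) ≤ exp (-1 : ℤ) * exp (-2 : ℤ) * 1 :=
          mul_le_mul' (mul_le_mul' le_rfl hb₄) hRS
        _ ≤ exp (-2 : ℤ) := by rw [mul_one, ← exp_add, exp_le_exp]; norm_num
    · rw [map_mul, w3, hb₆, ← exp_add, exp_le_exp]; norm_num
  have h12 : w (12 * r ^ 3) = exp (-1 : ℤ) := by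
    rw [show (12 : F) = 3 * 4 by norm_num, map_mul, map_mul, map_pow, w3, w4, wr, one_pow, mul_one, mul_one]
  have hlt : w (3 * b₂ * r ^ 2 + 3 * ((s - r) * (s ^ 2 + 2 * r * s + 3 * r ^ 2)) +
      b₂ * ((s - r) * (s + 2 * r)) + 3 * b₄ * (r + s) + 3 * b₆) < w (12 * r ^ 3) := by
    rw [h12]; exact lt_of_le_of_lt hE (by rw [exp_lt_exp]; norm_num)
  have hval := Valuation.map_add_eq_of_lt_left w hlt
  rw [← hsplit, hq, map_zero, h12] at hval
  exact exp_ne_zero hval.symm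

end Valued

end Summit.BirchSwinnertonDyer.BirchSwinnertonDyer.Theorems.PSLocalThreeTorsion

end
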